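import Summits.NavierStokesRegularity.FunctionalMining.TopBotEigMomentLawTwo
import Summits.NavierStokesRegularity.FunctionalMining.NoGo.TopBotEigHeatCoerciveGtTwo
import HarnessLib

/-!
# FunctionalMining/NoGo — K31: door D-K6 (c) for EVERY REAL `q ≥ 2`, BY NAME in the kernel: the candidate
# law `TopBotEigMomentLaw q` of the symmetrised core `Φ_q + Ψ_q` HOLDS, no family-type kill of it exists,
# and the kernel window of `C_λ^sym(q)` has an explicit positive lower edge

HONEST FRAMING. search for candidate a priori estimates; no regularity claim. Cell `pub-nsfunc`, no-go seat
(gen 44, touch 5), STAGED for the prove seat (the planner seat cannot file under `FunctionalMining/`; see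
`pub-nsfunc-nogo/NoGo/STAGING.md`). PURE COMPOSITION of TREE theorems, all used BY NAME; imports tree-only
(`TopBotEigMomentLawTwo` = prove g26's J1/(W1) corollary file, which brings K5 `NoGo.TopBotEigSaturatingSup`,
K6 `NoGo.TopBotEigHeatWindow`, K7/K8; and K10d `NoGo.TopBotEigHeatCoerciveGtTwo`). Nothing is computed here.

WHY THIS FILE. The tree decides door (c) of `NOGO.md` §3 D-K6 positively for every real `q ≥ 2`, but only in
pieces: K5 `topBotEigMomentLaw_of_heatCoercivePos : 2 ≤ q → TopBotEigHeatCoercivePos q → TopBotEigMomentLaw q`,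
K7 `topBotEigHeatCoercivePos_two`, K10d `topBotEigHeatCoercivePos_of_two_lt : 2 < q → TopBotEigHeatCoercivePos q`,
and J1 `topBotEigMomentLaw_two : TopBotEigMomentLaw 2`. The dictionary's `@[conjecture]` node
`TopBotEigMomentLaw q` (`SpectralMixtureCandidates.lean`) had no kernel theorem by name off the row `q = 2`.
This file states the compositions once, so that `NOGO.md` can cite ONE name per claim:

* §1 **`topBotEigHeatCoercivePos_of_two_le : 2 ≤ q → TopBotEigHeatCoercivePos q`** (K7 ∪ K10d) and
  **`topBotEigMomentLaw_of_two_le : 2 ≤ q → TopBotEigMomentLaw q`** — the candidate law K1-Q6 (c)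
  `∃ κ ≥ 0, SaturatingLawSup (Φ_q + Ψ_q) (2q−3) ((3q−3)/(2q−3)) κ` HOLDS for every real `q ≥ 2`, along every
  zero-mean classical solution of unforced Navier–Stokes on `T³` (the `Sup` law of record; `κ` existential, as
  everywhere in the tree's L-λ template); `_eventually_of_two_le` (all larger `κ`); the law fed with the tree's
  explicit crude heat rate `shareConst q · q / (2 · npConst q)` (`q > 2`, K10d).
* §2 Rows by value: `TopBotEigMomentLaw 3`, `TopBotEigMomentLaw 4`, the exponent pairs `(σ, γ) = (3, 2)` at
  `q = 3`, `(5, 9/5)` at `q = 4`, `(2, 9/4)` at `q = 5/2` — unconditionally (K5's `_rows` were conditional on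
  the heat node), and the three K0 rows `q = 2, 3, 4` in one conjunction.
* §3 **NO-GO FOR KILLS (the no-go seat's instruction (ii), exact scope real `q ≥ 2`):**
  **`not_forall_not_topBotEigMoment_saturatingLawSup : 2 ≤ q → ¬ ∀ κ, ¬ SaturatingLawSup (Φ_q + Ψ_q) (2q−3) ((3q−3)/(2q−3)) κ`**
  — no theorem in the conclusion shape of the door's family kills (`NoGo/TopEigSaturatingKill`: the ONE-SIDED
  core `Φ_q` alone, conditional on a heat-vanishing family) can exist for the symmetrised core at any real
  `q ≥ 2`; equivalently `0 < C_λ^sym(q)` (`topBotEigHeatRate_pos_of_two_le`). On paper this was the census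
  reading (W-5) "W18 kills `Φ_q + Ψ_q` from neither sign"; here it is a kernel fact, for every admissible family.
* §4 The KERNEL WINDOW of `C_λ^sym(q) = topBotEigHeatRate q` (K6: `[C_λ(q), 4π²q]`, lower end possibly `0`)
  gets an EXPLICIT POSITIVE lower edge for every real `q > 2`:
  `topBotEigHeatRate_mem_Icc_of_two_lt : topBotEigHeatRate q ∈ Icc (shareConst q · q / (2 · npConst q)) (4π²q)`;
  at `q = 4`: `topBotEigHeatRate 4 ∈ Icc (1/26541432) (16π²)` (`shareConst 4 = 1/999`, `npConst 4 = 53136`).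
  The SHARP-SHARE edge `cAxi q · q / (2 · npConst q)` (`1/119556` at `q = 4`) is the staged K30
  `NoGo.TopBotEigHeatCoerciveSharpShare` (§4 there), which needs the staged wall chain K16–K29; this file does not.

NOT claimed: no value of `κ`; nothing for `q < 2` (door (c) below two is K12 `NoGo.TopBotEigHeatCoerciveLtTwo` +
the prove seat's planar lane, conditional on the splitting there); nothing on the one-sided rows `Φ_q`, `Ψ_q`
(dead on paper, T35/W18; kernel instance (D3)/(F2) WANTED); the window's true value `C_λ^sym(q)` is not
computed; and nothing about Navier–Stokes regularity or blow-up — every statement is an implication between, or an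
instance of, candidate a priori inequalities along short-time classical solutions from smooth data. [ours]
FILING (prove seat g27, REQUEST #47): declarations byte-identical to the no-go seat's staged `TopBotEigMomentLawGeTwo.STAGING.lean` 20cdbff05de16a39; this line is the only addition.
-/

noncomputable section

open MeasureTheory Set
open scoped Real

namespace Summit.NavierStokesRegularity.FunctionalMining

open Literature.Analysis.FunctionSpaces Literature.Analysis.FunctionSpaces.Torus

namespace TopEig

/-! ## 1. The heat node and the law for every real `q ≥ 2` -/

/-- **`TopBotEigHeatCoercivePos q` for every real `q ≥ 2`** (K7 at `q = 2`, K10d above). [ours, composition] -/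
theorem topBotEigHeatCoercivePos_of_two_le {q : ℝ} (hq : 2 ≤ q) :
    TopBotEigHeatCoercivePos (d := Fin 3) q := by
  rcases hq.eq_or_lt with h | h
  · rw [← h]; exact topBotEigHeatCoercivePos_two
  · exact topBotEigHeatCoercivePos_of_two_lt h

/-- **`TopBotEigMomentLaw q` for every real `q > 2`** (K5 ∘ K10d). [ours, composition] -/
theorem topBotEigMomentLaw_of_two_lt {q : ℝ} (hq : 2 < q) : TopBotEigMomentLaw (d := Fin 3) q :=
  topBotEigMomentLaw_of_heatCoercivePos hq.le (topBotEigHeatCoercivePos_of_two_lt hq)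

/-- **THE CANDIDATE LAW K1-Q6 (c) HOLDS FOR EVERY REAL `q ≥ 2`: `TopBotEigMomentLaw q`**, i.e.
`∃ κ ≥ 0, SaturatingLawSup (Φ_q + Ψ_q) (2q−3) ((3q−3)/(2q−3)) κ` (K5 ∘ (K7 ∪ K10d)). [ours, composition] -/
theorem topBotEigMomentLaw_of_two_le {q : ℝ} (hq : 2 ≤ q) : TopBotEigMomentLaw (d := Fin 3) q :=
  topBotEigMomentLaw_of_heatCoercivePos hq (topBotEigHeatCoercivePos_of_two_le hq)

/-- The law unfolded: `∃ κ ≥ 0, SaturatingLawSup (Φ_q + Ψ_q) (2q−3) ((3q−3)/(2q−3)) κ`, every real `q ≥ 2`.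
[ours, composition] -/
theorem topBotEigMoment_saturatingLawSup_of_two_le {q : ℝ} (hq : 2 ≤ q) :
    ∃ κ : ℝ, 0 ≤ κ ∧
      SaturatingLawSup (d := Fin 3) (topBotEigMoment q) (2 * q - 3) ((3 * q - 3) / (2 * q - 3)) κ :=
  topBotEigMoment_saturatingLawSup_of_heatCoercivePos hq (topBotEigHeatCoercivePos_of_two_le hq)

/-- The law for all sufficiently large constants, every real `q ≥ 2`. [ours, composition] -/
theorem topBotEigMoment_saturatingLawSup_eventually_of_two_le {q : ℝ} (hq : 2 ≤ q) :
    ∃ κ₀ : ℝ, ∀ κ, κ₀ ≤ κ →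
      SaturatingLawSup (d := Fin 3) (topBotEigMoment q) (2 * q - 3) ((3 * q - 3) / (2 * q - 3)) κ :=
  topBotEigMoment_saturatingLawSup_eventually hq (topBotEigHeatCoercivePos_of_two_le hq)

/-- The tree's explicit crude heat rate of `Φ_q + Ψ_q` is positive: `0 < shareConst q · q / (2 · npConst q)`
(`q > 2`). [ours, bookkeeping] -/
theorem shareConst_rate_pos {q : ℝ} (hq : 2 < q) : 0 < shareConst q * q / (2 * npConst q) :=
  div_pos (mul_pos (shareConst_pos hq.le) (by linarith)) (mul_pos two_pos (npConst_pos hq))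

/-- The law fed with the tree's EXPLICIT heat rate `shareConst q · q / (2 · npConst q)` (K10d
`topBotEigMoment_heatCoercive_shareConst`) through K5's rate form, every real `q > 2` (the `κ` produced is
existential; only its provenance is by name). [ours, composition] -/
theorem topBotEigMoment_saturatingLawSup_of_shareConst {q : ℝ} (hq : 2 < q) :
    ∃ κ : ℝ, 0 ≤ κ ∧
      SaturatingLawSup (d := Fin 3) (topBotEigMoment q) (2 * q - 3) ((3 * q - 3) / (2 * q - 3)) κ :=
  topBotEigMoment_saturatingLawSup_of_heatCoercive hq.le (shareConst_rate_pos hq)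
    (topBotEigMoment_heatCoercive_shareConst hq)

/-! ## 2. Rows by value -/

/-- `TopBotEigMomentLaw 3`. [ours, composition] -/
theorem topBotEigMomentLaw_three : TopBotEigMomentLaw (d := Fin 3) 3 :=
  topBotEigMomentLaw_of_two_lt (by norm_num)

/-- `TopBotEigMomentLaw 4`. [ours, composition] -/
theorem topBotEigMomentLaw_four : TopBotEigMomentLaw (d := Fin 3) 4 :=
  topBotEigMomentLaw_of_two_lt (by norm_num)

/-- Row `q = 3` with the exponents by value, `(σ, γ) = (3, 2)`:
`∃ κ ≥ 0, SaturatingLawSup (Φ_3 + Ψ_3) 3 2 κ` — unconditionally. [ours, composition] -/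
theorem topBotEigMoment_three_saturatingLawSup :
    ∃ κ : ℝ, 0 ≤ κ ∧ SaturatingLawSup (d := Fin 3) (topBotEigMoment 3) 3 2 κ :=
  topBotEigMoment_saturatingLawSup_rows.2.1 (topBotEigHeatCoercivePos_of_two_lt (by norm_num))

/-- Row `q = 4` with the exponents by value, `(σ, γ) = (5, 9/5)`:
`∃ κ ≥ 0, SaturatingLawSup (Φ_4 + Ψ_4) 5 (9/5) κ` — unconditionally. [ours, composition] -/
theorem topBotEigMoment_four_saturatingLawSup :
    ∃ κ : ℝ, 0 ≤ κ ∧ SaturatingLawSup (d := Fin 3) (topBotEigMoment 4) 5 (9 / 5) κ :=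
  topBotEigMoment_saturatingLawSup_rows.2.2 topBotEigHeatCoercivePos_four

/-- A non-integer row, `q = 5/2`, `(σ, γ) = (2, 9/4)`: `∃ κ ≥ 0, SaturatingLawSup (Φ_{5/2} + Ψ_{5/2}) 2 (9/4) κ`.
[ours, composition] -/
theorem topBotEigMoment_fiveHalves_saturatingLawSup :
    ∃ κ : ℝ, 0 ≤ κ ∧ SaturatingLawSup (d := Fin 3) (topBotEigMoment (5 / 2)) 2 (9 / 4) κ := by
  have h := topBotEigMoment_saturatingLawSup_of_two_le (q := 5 / 2) (by norm_num)
  norm_num at h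
  exact h

/-- **The three K0 rows `q = 2, 3, 4` of door (c) HOLD** (exponents `(1, 3)`, `(3, 2)`, `(5, 9/5)`), in one
conjunction (row `2`: J1 `topBotEigMoment_two_saturatingLawSup`). [ours, composition] -/
theorem topBotEigMoment_saturatingLawSup_rows_hold :
    (∃ κ : ℝ, 0 ≤ κ ∧ SaturatingLawSup (d := Fin 3) (topBotEigMoment 2) 1 3 κ) ∧
    (∃ κ : ℝ, 0 ≤ κ ∧ SaturatingLawSup (d := Fin 3) (topBotEigMoment 3) 3 2 κ) ∧
    (∃ κ : ℝ, 0 ≤ κ ∧ SaturatingLawSup (d := Fin 3) (topBotEigMoment 4) 5 (9 / 5) κ) :=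
  ⟨topBotEigMoment_two_saturatingLawSup, topBotEigMoment_three_saturatingLawSup,
    topBotEigMoment_four_saturatingLawSup⟩

/-! ## 3. No-go for kills of the symmetrised core (instruction (ii); exact scope: every real `q ≥ 2`) -/

/-- **NO FAMILY-TYPE KILL OF `Φ_q + Ψ_q` EXISTS, any real `q ≥ 2`:**
`¬ ∀ κ, ¬ SaturatingLawSup (Φ_q + Ψ_q) (2q−3) ((3q−3)/(2q−3)) κ`. A kernel theorem in the conclusion shape of
the door's family kills (as `NoGo/TopEigSaturatingKill` for `Φ_q` alone) would contradict §1 (through K5's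
`not_topBotEigHeatCoercivePos_of_forall_not_law`). [ours, composition] -/
theorem not_forall_not_topBotEigMoment_saturatingLawSup {q : ℝ} (hq : 2 ≤ q) :
    ¬ ∀ κ : ℝ,
      ¬ SaturatingLawSup (d := Fin 3) (topBotEigMoment q) (2 * q - 3) ((3 * q - 3) / (2 * q - 3)) κ :=
  fun hkill => not_topBotEigHeatCoercivePos_of_forall_not_law hq hkill (topBotEigHeatCoercivePos_of_two_le hq)

/-- The same, positively: some constant `κ` makes the `Sup` law of `Φ_q + Ψ_q` true (every real `q ≥ 2`).
[ours, composition] -/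
theorem exists_topBotEigMoment_saturatingLawSup {q : ℝ} (hq : 2 ≤ q) :
    ∃ κ : ℝ, SaturatingLawSup (d := Fin 3) (topBotEigMoment q) (2 * q - 3) ((3 * q - 3) / (2 * q - 3)) κ := by
  obtain ⟨κ, _, h⟩ := topBotEigMoment_saturatingLawSup_of_two_le hq
  exact ⟨κ, h⟩

/-- **`0 < C_λ^sym(q)`** for every real `q ≥ 2` (K6's `topBotEigHeatCoercivePos_iff_rate_pos`). [ours, composition] -/
theorem topBotEigHeatRate_pos_of_two_le {q : ℝ} (hq : 2 ≤ q) : 0 < topBotEigHeatRate q :=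
  (topBotEigHeatCoercivePos_iff_rate_pos (by linarith)).1 (topBotEigHeatCoercivePos_of_two_le hq)

/-- `C_λ^sym(q) ≠ 0` for every real `q ≥ 2`: the negative side of (c)'s heat node
(`not_topBotEigHeatCoercivePos_iff_rate_eq_zero`) is refuted on `[2, ∞)`. [ours, composition] -/
theorem topBotEigHeatRate_ne_zero_of_two_le {q : ℝ} (hq : 2 ≤ q) : topBotEigHeatRate q ≠ 0 :=
  (topBotEigHeatRate_pos_of_two_le hq).ne'

/-- The negative heat node is FALSE for every real `q ≥ 2`: `¬ ¬ TopBotEigHeatCoercivePos q`. [ours, composition] -/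
theorem not_not_topBotEigHeatCoercivePos_of_two_le {q : ℝ} (hq : 2 ≤ q) :
    ¬ ¬ TopBotEigHeatCoercivePos (d := Fin 3) q :=
  fun h => h (topBotEigHeatCoercivePos_of_two_le hq)

/-! ## 4. The kernel window of `C_λ^sym(q)` with an explicit positive lower edge (every real `q > 2`) -/

/-- **Lower edge by name: `shareConst q · q / (2 · npConst q) ≤ C_λ^sym(q)`** (`q > 2`; K10d's explicit heat
coercivity through K6's `topBotEigHeatCoercive_iff_le_rate`). [ours, composition] -/
theorem shareConst_rate_le_topBotEigHeatRate {q : ℝ} (hq : 2 < q) :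
    shareConst q * q / (2 * npConst q) ≤ topBotEigHeatRate q :=
  (topBotEigHeatCoercive_iff_le_rate (by linarith)).1 (topBotEigMoment_heatCoercive_shareConst hq)

/-- **KERNEL WINDOW with a positive explicit lower edge:
`C_λ^sym(q) ∈ [shareConst q · q / (2 · npConst q), 4π²q]`**, every real `q > 2` (upper end: K6's
`topBotEigHeatRate_le`, the single-shell crossed shear). [ours, composition] -/
theorem topBotEigHeatRate_mem_Icc_of_two_lt {q : ℝ} (hq : 2 < q) :
    topBotEigHeatRate q ∈ Icc (shareConst q * q / (2 * npConst q)) (4 * π ^ 2 * q) :=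
  ⟨shareConst_rate_le_topBotEigHeatRate hq, topBotEigHeatRate_le (by linarith)⟩

/-- The window keeps K6's one-sided lower end too: `max (C_λ(q)) (shareConst-rate) ≤ C_λ^sym(q)` (`q > 2`).
[ours, composition] -/
theorem max_le_topBotEigHeatRate_of_two_lt {q : ℝ} (hq : 2 < q) :
    max (topEigHeatRate q) (shareConst q * q / (2 * npConst q)) ≤ topBotEigHeatRate q :=
  max_le (topEigHeatRate_le_topBotEigHeatRate (by linarith)) (shareConst_rate_le_topBotEigHeatRate hq)

/-- **Row `q = 4` by value: `C_λ^sym(4) ∈ [1/26541432, 16π²]`** (`shareConst 4 = 1/999`,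
`npConst 4 = 6·(1+3⁴)·2²·3³ = 53136`, `(1/999)·4/(2·53136) = 1/26541432`). The staged K30 sharpens the lower
edge to `1/119556`. [ours, composition + arithmetic] -/
theorem topBotEigHeatRate_four_mem_Icc :
    topBotEigHeatRate 4 ∈ Icc (1 / 26541432 : ℝ) (16 * π ^ 2) := by
  have hnp : npConst 4 = 53136 := by
    unfold npConst
    rw [show (1 : ℝ) + (4 / 2 - 1) = 2 by norm_num, Real.rpow_two]
    norm_num
  have h := topBotEigHeatRate_mem_Icc_of_two_lt (q := 4) (by norm_num)
  rw [shareConst_four, hnp] at h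
  constructor
  · have h1 := h.1
    have e : (1 / 999 * 4 / (2 * 53136) : ℝ) = 1 / 26541432 := by norm_num
    linarith
  · have h2 := h.2
    linarith

/-- `0 < C_λ^sym(4)` and `C_λ^sym(4) ≠ 0`, by value. [ours, composition] -/
theorem topBotEigHeatRate_four_pos : 0 < topBotEigHeatRate 4 :=
  topBotEigHeatRate_pos_of_two_le (by norm_num)

/-! ## 5. Door (c) on `[2, ∞)` in one statement -/

/-- **DOOR D-K6 (c), every real `q ≥ 2`, in one conjunction:** the heat node, the candidate law, the
positivity of `C_λ^sym(q)`, and the impossibility of a family-type kill. [ours, composition] -/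
theorem topBotEig_doorC_of_two_le {q : ℝ} (hq : 2 ≤ q) :
    TopBotEigHeatCoercivePos (d := Fin 3) q ∧ TopBotEigMomentLaw (d := Fin 3) q ∧
      0 < topBotEigHeatRate q ∧
      ¬ ∀ κ : ℝ,
        ¬ SaturatingLawSup (d := Fin 3) (topBotEigMoment q) (2 * q - 3) ((3 * q - 3) / (2 * q - 3)) κ :=
  ⟨topBotEigHeatCoercivePos_of_two_le hq, topBotEigMomentLaw_of_two_le hq, topBotEigHeatRate_pos_of_two_le hq,
    not_forall_not_topBotEigMoment_saturatingLawSup hq⟩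

end TopEig

end Summit.NavierStokesRegularity.FunctionalMining

end
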